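import Literature.MathematicalPhysics.QuantumManyBody.PeriodicHeatFlowSpectralProofs
import Literature.MathematicalPhysics.QuantumManyBody.PeriodicFeynmanKacPerronFrobenius
import Literature.MathematicalPhysics.QuantumManyBody.PeriodicFeynmanKacEnergyLower
import Literature.MathematicalPhysics.QuantumManyBody.GroundStateFeynmanKacSpectral
import HarnessLib

/-!
# Near-minimiser rigidity on the torus, I: Jensen's bound for the Feynman–Kac semigroup
# (support for stub `stub_nearMinimiserRigidity` of line `healing-scale-kac-insertion`,
# crux `BECInsertionCorrector.CorrectorClosure`, item stmt-AtomisticToContinuum-12058)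

Part 1 of 3. Fixed particle number `M`, box `L > 0`, measurable pair potential `v` with BOUNDED
periodisation `v^per ≤ C`; `T_t = pfkL2 v L t = e^{-tH}` is the torus Feynman–Kac semigroup on the real
Hilbert space `L²([0,L)^{3M})` (`PeriodicFeynmanKacOperator*.lean`), `E₀ = periodicGroundStateEnergy v M L`.

* `inner_le_two_level` — the abstract two-level bound `⟪Tx, x⟫ ≤ λ⟪e,x⟫² + M₁(‖x‖² - ⟪e,x⟫²)` for a
  symmetric `T` with `Te = λe` and `‖T·‖ ≤ M₁‖·‖` on `e^⊥`;
* `L²(cell)` bookkeeping for classes `[f] = MemLp.toLp f` of bounded periodic functions: `⟪[f],[g]⟫ = ∫fg`,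
  `‖[f]‖² = ∫f²`, `⟪T_t[g],[f]⟫ = ∫ f·e^{-tH}g` (`inner_pfkL2_toLp`), and the class of a Feynman–Kac ground
  state `Ψ₀` (`IsPeriodicGroundStateFK`) is a unit eigenvector of `T_t` with eigenvalue `e^{-tE₀}`;
* `norm_pfkL2_eq_and_gap` — `‖T_1‖ = e^{-E₀}` and the spectral gap `‖T_1 x‖ ≤ M₁‖x‖` on `[Ψ₀]^⊥`,
  `M₁ < e^{-E₀}` (Perron–Frobenius `pfkL2_perronFrobenius` + `exists_gap_of_simple`);
* `exp_neg_energy_le_inner_pfkL2`, `exp_neg_energy_le_pairing` (registered sub-goal) — **Jensen's bound**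
  `e^{-(𝓔ℝ[f]+𝓔ℝ[g])} ≤ ⟨f,T_1f⟩ + ⟨g,T_1g⟩` for periodic `C¹` real `f, g` of total mass one, from
  log-convexity `Z(s/2)² ≤ Z(s)` and the small-time form bound (no spectral theorem needed).
References: Reed–Simon IV Thm XIII.44 [ReedSimonIV1978]; Chung–Zhao (1995) Thm 3.27, Prop 3.29 [ChungZhao1995].
-/

noncomputable section

open MeasureTheory Filter Matrix
open scoped ENNReal NNReal ComplexConjugate InnerProductSpace Topology

namespace Summit.AtomisticToContinuum.BoseEinsteinCondensation.Theorems.CorrectorClosure.HealingScaleKacInsertion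

open Literature.MathematicalPhysics.QuantumManyBody.BoseGas

/-! ### The two-level bound in a real Hilbert space -/

/-- **Two-level bound.** If `T` is symmetric, `T e = λ e` for a unit vector `e`, and
`‖T x‖ ≤ M₁ ‖x‖` on `e^⊥`, then `⟪T x, x⟫ ≤ λ ⟪e, x⟫² + M₁ (‖x‖² - ⟪e, x⟫²)` for every `x`
(split `x = ⟪e, x⟫ e + x^⊥`). [folklore] -/
theorem inner_le_two_level {E : Type*} [NormedAddCommGroup E] [InnerProductSpace ℝ E]
    (T : E →L[ℝ] E) (hsym : ∀ x y, ⟪T x, y⟫_ℝ = ⟪x, T y⟫_ℝ) {e : E} (he : ‖e‖ = 1) {lam M₁ : ℝ}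
    (hTe : T e = lam • e) (hgap : ∀ x, ⟪e, x⟫_ℝ = 0 → ‖T x‖ ≤ M₁ * ‖x‖) (x : E) :
    ⟪T x, x⟫_ℝ ≤ lam * ⟪e, x⟫_ℝ ^ 2 + M₁ * (‖x‖ ^ 2 - ⟪e, x⟫_ℝ ^ 2) := by
  set a : ℝ := ⟪e, x⟫_ℝ with ha
  set x' : E := x - a • e with hx'
  have hee : ⟪e, e⟫_ℝ = 1 := by rw [real_inner_self_eq_norm_sq, he, one_pow]
  have hperp : ⟪e, x'⟫_ℝ = 0 := by
    rw [hx', inner_sub_right, inner_smul_right, hee, ← ha]; ring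
  have hnorm : ‖x'‖ ^ 2 = ‖x‖ ^ 2 - a ^ 2 := by
    rw [hx', norm_sub_sq_real, inner_smul_right, real_inner_comm, ← ha, norm_smul, Real.norm_eq_abs,
      he, mul_one, sq_abs]; ring
  have hx : x = a • e + x' := by rw [hx']; abel
  have hTx'e : ⟪T x', e⟫_ℝ = 0 := by
    rw [hsym, hTe, inner_smul_right, real_inner_comm, hperp, mul_zero]
  have hexp : ⟪T x, x⟫_ℝ = lam * a ^ 2 + ⟪T x', x'⟫_ℝ := by
    conv_lhs => rw [hx]
    rw [map_add, map_smul, hTe, smul_smul, inner_add_left, inner_add_right, inner_add_right,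
      inner_smul_left, inner_smul_left, inner_smul_right, inner_smul_right, hee, hperp, hTx'e]
    simp only [conj_trivial]; ring
  have hb : ⟪T x', x'⟫_ℝ ≤ M₁ * ‖x'‖ ^ 2 := by
    calc ⟪T x', x'⟫_ℝ ≤ ‖T x'‖ * ‖x'‖ := real_inner_le_norm _ _
      _ ≤ M₁ * ‖x'‖ * ‖x'‖ := mul_le_mul_of_nonneg_right (hgap x' hperp) (norm_nonneg _)
      _ = M₁ * ‖x'‖ ^ 2 := by ring
  rw [hexp, ← hnorm]
  linarith

/-! ### `L²(cell)` classes of bounded periodic functions and the torus Feynman–Kac operator -/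

variable {M : ℕ} {L : ℝ} {v : ℝ → ℝ≥0∞}

/-- `⟪[f], [g]⟫ = ∫_cell f g` for the `L²(cell)` classes of two functions. [folklore] -/
theorem inner_toLp_cellN {f g : Config M → ℝ} (hf : MemLp f 2 (volume.restrict (cellN M L)))
    (hg : MemLp g 2 (volume.restrict (cellN M L))) :
    ⟪hf.toLp f, hg.toLp g⟫_ℝ = ∫ X in cellN M L, f X * g X := by
  rw [inner_Lp_eq_integral]
  refine integral_congr_ae ?_
  filter_upwards [hf.coeFn_toLp, hg.coeFn_toLp] with X h1 h2
  rw [h1, h2]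

/-- `‖[f]‖² = ∫_cell f²` in `[0, ∞]`. [folklore] -/
theorem ofReal_norm_toLp_sq {f : Config M → ℝ} (hf : MemLp f 2 (volume.restrict (cellN M L))) :
    ENNReal.ofReal (‖hf.toLp f‖ ^ 2) = ∫⁻ X in cellN M L, ENNReal.ofReal (f X ^ 2) := by
  rw [ofReal_norm_sq_eq_lintegral_enorm_sq]
  refine lintegral_congr_ae ?_
  filter_upwards [hf.coeFn_toLp] with X hX
  rw [hX, ← ofReal_norm, Real.norm_eq_abs, ← ENNReal.ofReal_pow (abs_nonneg _), sq_abs]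

/-- `‖[f]‖² = ∫_cell f²` in `ℝ`. [folklore] -/
theorem norm_toLp_sq {f : Config M → ℝ} (hf : MemLp f 2 (volume.restrict (cellN M L))) :
    ‖hf.toLp f‖ ^ 2 = ∫ X in cellN M L, f X ^ 2 := by
  rw [← toReal_lintegral_sq hf.integrable_sq, ← ofReal_norm_toLp_sq hf,
    ENNReal.toReal_ofReal (sq_nonneg _)]

/-- `⟪e^{-tH}[g], [f]⟫ = ∫_cell f · e^{-tH} g` for periodic `g` (`t > 0`, `L > 0`). [folklore] -/
theorem inner_pfkL2_toLp (hv : Measurable v) (hL : 0 < L) {t : ℝ} (ht : 0 < t) {f g : Config M → ℝ}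
    (hf : MemLp f 2 (volume.restrict (cellN M L))) (hg : MemLp g 2 (volume.restrict (cellN M L)))
    (hgper : ∀ (X : Config M) (i : Fin M) (k : Fin 3),
      g (X + Pi.single i (EuclideanSpace.single k L)) = g X) :
    ⟪pfkL2 v L t (hg.toLp g), hf.toLp f⟫_ℝ = ∫ X in cellN M L, f X * pfkReal v L t g X := by
  rw [inner_Lp_eq_integral]
  refine integral_congr_ae ?_
  filter_upwards [pfkL2_coeFn hv hL ht (hg.toLp g), hf.coeFn_toLp] with X h1 h2
  rw [h1, h2, pfkReal_comp_cellProj_congr_ae v hL ht hg.coeFn_toLp X, comp_cellProj_eq_self hgper,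
    mul_comm]

/-- **The class of a Feynman–Kac ground state is an eigenvector of `e^{-tH}` on `L²(cell)`** with
eigenvalue `e^{-tE₀}`, `E₀ = periodicGroundStateEnergy v M L`. [folklore] -/
theorem pfkL2_toLp_groundState (hv : Measurable v) (hL : 0 < L) {t : ℝ} (ht : 0 < t)
    {Ψ₀ : Config M → ℝ} (hΨ : IsPeriodicGroundStateFK v L Ψ₀)
    (h0 : MemLp Ψ₀ 2 (volume.restrict (cellN M L))) :
    pfkL2 v L t (h0.toLp Ψ₀) =
      Real.exp (-((periodicGroundStateEnergy v M L).toReal * t)) • h0.toLp Ψ₀ := by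
  rw [pfkL2_apply hv hL ht, ← MemLp.toLp_const_smul]
  refine MemLp.toLp_congr _ _ (Eventually.of_forall fun X => ?_)
  rw [pfkReal_comp_cellProj_congr_ae v hL ht h0.coeFn_toLp X, comp_cellProj_eq_self hΨ.periodic,
    Pi.smul_apply, smul_eq_mul, pfkReal_eq_toReal_periodicFKSemigroup hv L t hΨ.measurable hΨ.nonneg X,
    hΨ.eigen t ht.le X, ENNReal.toReal_ofReal (mul_nonneg (Real.exp_pos _).le (hΨ.nonneg X))]

/-- The class of a cell-normalised nonnegative function is a unit vector. [folklore] -/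
theorem norm_toLp_groundState {Ψ₀ : Config M → ℝ} (hΨ : IsPeriodicGroundStateFK v L Ψ₀)
    (h0 : MemLp Ψ₀ 2 (volume.restrict (cellN M L))) : ‖h0.toLp Ψ₀‖ = 1 := by
  have h1 : ENNReal.ofReal (‖h0.toLp Ψ₀‖ ^ 2) = 1 := by
    rw [ofReal_norm_toLp_sq h0, ← hΨ.norm_eq]
    refine lintegral_congr fun X => ?_
    rw [ENNReal.ofReal_pow (hΨ.nonneg X)]
  have h2 : ‖h0.toLp Ψ₀‖ ^ 2 = 1 := by
    have := congrArg ENNReal.toReal h1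
    rwa [ENNReal.toReal_ofReal (sq_nonneg _), ENNReal.toReal_one] at this
  exact (pow_left_inj₀ (norm_nonneg _) zero_le_one two_ne_zero).1 (by rw [h2, one_pow])


/-- A continuous periodic function has an `L²(cell)` class (`L > 0`). [folklore] -/
theorem memLp_two_cellN_of_continuous_periodic (hL : 0 < L) {f : Config M → ℝ} (hf : Continuous f)
    (hper : ∀ (X : Config M) (i : Fin M) (k : Fin 3),
      f (X + Pi.single i (EuclideanSpace.single k L)) = f X) :
    MemLp f 2 (volume.restrict (cellN M L)) := by
  obtain ⟨B, -, hB⟩ := exists_bound_of_continuous_periodic hL hf hper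
  exact memLp_two_cellN_of_bound L hf.measurable hB

/-! ### The top of the spectrum of `e^{-H}` and the gap below it, given a Feynman–Kac ground state -/

/-- **`‖e^{-H}‖ = e^{-E₀}` and the spectral gap on `Ψ₀^⊥`.** For `L > 0`, measurable `v` with
bounded periodisation and a strictly positive Feynman–Kac ground state `Ψ₀` (`IsPeriodicGroundStateFK`):
the class `[Ψ₀]` is a Perron–Frobenius eigenvector of the compact positive self-adjoint operator
`T = pfkL2 v L 1` (it pairs positively with the a.e. positive top eigenvector, so its eigenvalue
`e^{-E₀}` is `‖T‖`), the `‖T‖`-eigenspace is spanned by `[Ψ₀]` (`pfkL2_perronFrobenius`), hence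
`‖T x‖ ≤ M₁‖x‖` on `[Ψ₀]^⊥` for some `0 ≤ M₁ < e^{-E₀}` (`exists_gap_of_simple`).
[cite: ReedSimonIV1978, Thm XIII.44] -/
theorem norm_pfkL2_eq_and_gap (hv : Measurable v) (hL : 0 < L) {C : ℝ≥0}
    (hC : ∀ x, periodizedPotential v L x ≤ C) {Ψ₀ : Config M → ℝ}
    (hΨ : IsPeriodicGroundStateFK v L Ψ₀) (hpos : ∀ X, 0 < Ψ₀ X)
    (h0 : MemLp Ψ₀ 2 (volume.restrict (cellN M L))) :
    ‖(pfkL2 v L 1 : Lp ℝ 2 (volume.restrict (cellN M L)) →L[ℝ] _)‖ =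
        Real.exp (-(periodicGroundStateEnergy v M L).toReal) ∧
      ∃ M₁ : ℝ, M₁ < Real.exp (-(periodicGroundStateEnergy v M L).toReal) ∧ 0 ≤ M₁ ∧
        ∀ x : Lp ℝ 2 (volume.restrict (cellN M L)), ⟪h0.toLp Ψ₀, x⟫_ℝ = 0 →
          ‖pfkL2 v L 1 x‖ ≤ M₁ * ‖x‖ := by
  set μc : Measure (Config M) := volume.restrict (cellN M L) with hμc
  set T : Lp ℝ 2 μc →L[ℝ] Lp ℝ 2 μc := pfkL2 v L 1 with hT
  set lam : ℝ := Real.exp (-(periodicGroundStateEnergy v M L).toReal) with hlam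
  have hsym : ∀ x y, ⟪T x, y⟫_ℝ = ⟪x, T y⟫_ℝ := fun x y => inner_pfkL2_comm hv hL one_pos x y
  have hposT : ∀ x, 0 ≤ ⟪T x, x⟫_ℝ := fun x => inner_pfkL2_self_nonneg hv hL one_pos x
  have hc : IsCompactOperator T := isCompactOperator_pfkL2 hv hL hC one_pos
  obtain ⟨hT0, e, he1, -, hTe, hepos, hsimp⟩ := pfkL2_perronFrobenius (N := M) hv hL hC one_pos
  set x₀ : Lp ℝ 2 μc := h0.toLp Ψ₀ with hx₀
  have hx₀1 : ‖x₀‖ = 1 := norm_toLp_groundState hΨ h0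
  have hTx₀ : T x₀ = lam • x₀ := by
    have h := pfkL2_toLp_groundState hv hL one_pos hΨ h0
    rwa [mul_one] at h
  -- `⟪x₀, e⟫ > 0`, hence `lam = ‖T‖`
  have hx₀pos : ∀ᵐ X ∂μc, 0 < (x₀ : Config M → ℝ) X := by
    filter_upwards [h0.coeFn_toLp] with X hX
    rw [hX]; exact hpos X
  have hinner : 0 < ⟪x₀, e⟫_ℝ := inner_pos_of_ae_pos (restrict_cellN_ne_zero M hL) hx₀pos hepos
  have hnorm : ‖T‖ = lam := by
    have h := hsym x₀ e
    rw [hTx₀, hTe, inner_smul_left, inner_smul_right] at h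
    simp only [conj_trivial] at h
    exact (mul_right_cancel₀ hinner.ne' h).symm
  -- the `‖T‖`-eigenspace is spanned by `x₀`
  have hTx₀' : T x₀ = ‖T‖ • x₀ := by rw [hnorm]; exact hTx₀
  obtain ⟨c₀, hc₀⟩ := hsimp x₀ hTx₀'
  have hc₀0 : c₀ ≠ 0 := by
    rintro rfl
    rw [zero_smul] at hc₀
    rw [hc₀, norm_zero] at hx₀1
    exact zero_ne_one hx₀1
  have hsimp' : ∀ f, T f = ‖T‖ • f → ∃ c : ℝ, f = c • x₀ := by
    intro f hf
    obtain ⟨c, rfl⟩ := hsimp f hf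
    refine ⟨c * c₀⁻¹, ?_⟩
    rw [hc₀, smul_smul, mul_assoc, inv_mul_cancel₀ hc₀0, mul_one]
  obtain ⟨M₁, hM₁, hM₁0, hgap⟩ := exists_gap_of_simple T hsym hposT hc hT0 hx₀1 hTx₀' hsimp'
  rw [hnorm] at hM₁
  exact ⟨hnorm, M₁, hM₁, hM₁0, hgap⟩


/-! ### Jensen's bound `e^{-𝓔[Ψ]} ≤ ⟨Ψ, e^{-H}Ψ⟩` from log-convexity and the small-time form bound -/

/-- `e^{-b/(1-b)} ≤ 1 - b` for `0 ≤ b < 1` (from `1 + y ≤ e^y` at `y = b/(1-b)`). [folklore] -/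
theorem exp_neg_div_le_one_sub {b : ℝ} (hb0 : 0 ≤ b) (hb1 : b < 1) :
    Real.exp (-(b / (1 - b))) ≤ 1 - b := by
  have h1b : 0 < 1 - b := by linarith
  have hy0 : 0 ≤ b / (1 - b) := div_nonneg hb0 h1b.le
  have h1 : b / (1 - b) + 1 = (1 - b)⁻¹ := by field_simp; ring
  rw [Real.exp_neg]
  calc (Real.exp (b / (1 - b)))⁻¹ ≤ (b / (1 - b) + 1)⁻¹ :=
        inv_anti₀ (by linarith) (Real.add_one_le_exp _)
    _ = 1 - b := by rw [h1, inv_inv]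

/-- **Log-convexity plus a one-sided derivative at `0` give an exponential lower bound.** If
`Z ≥ 0` on `(0, ∞)` satisfies `Z(s/2)² ≤ Z(s)` and `Z(s) ≥ 1 - sĒ - K s√s` for `s > 0`
(`Ē, K ≥ 0`), then `e^{-Ē} ≤ Z(1)`: indeed `Z(1) ≥ Z(2^{-m})^{2^m} ≥ (1 - b_m)^{2^m} ≥
e^{-(Ē + K 2^{-m/2})/(1 - b_m)} → e^{-Ē}`, `b_m = 2^{-m}Ē + K 2^{-3m/2}`. [folklore] -/
theorem exp_neg_le_of_sq_half_le {Z : ℝ → ℝ} {Ē K : ℝ} (hĒ : 0 ≤ Ē) (hK : 0 ≤ K)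
    (hZsq : ∀ s, 0 < s → Z (s / 2) ^ 2 ≤ Z s)
    (hZlow : ∀ s, 0 < s → 1 - (s * Ē + K * (s * Real.sqrt s)) ≤ Z s) :
    Real.exp (-Ē) ≤ Z 1 := by
  -- iterate: `Z(2^{-m})^{2^m} ≤ Z(1)`
  have hZpow : ∀ m : ℕ, Z ((1 / 2 : ℝ) ^ m) ^ (2 ^ m) ≤ Z 1 := by
    intro m
    induction m with
    | zero => simp
    | succ m ih =>
      have hsm : (0 : ℝ) < (1 / 2) ^ m := by positivity
      have h1 : (1 / 2 : ℝ) ^ (m + 1) = (1 / 2) ^ m / 2 := by rw [pow_succ]; ring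
      calc Z ((1 / 2 : ℝ) ^ (m + 1)) ^ 2 ^ (m + 1) = (Z ((1 / 2) ^ m / 2) ^ 2) ^ 2 ^ m := by
            rw [h1, ← pow_mul, pow_succ' 2 m]
        _ ≤ Z ((1 / 2) ^ m) ^ 2 ^ m := pow_le_pow_left₀ (sq_nonneg _) (hZsq _ hsm) _
        _ ≤ Z 1 := ih
  -- the bound at level `m`
  have hkey : ∀ m : ℕ, (1 / 2 : ℝ) ^ m * Ē + K * ((1 / 2 : ℝ) ^ m * Real.sqrt ((1 / 2 : ℝ) ^ m)) < 1 →
      Real.exp (-((Ē + K * Real.sqrt ((1 / 2 : ℝ) ^ m)) /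
        (1 - ((1 / 2 : ℝ) ^ m * Ē + K * ((1 / 2 : ℝ) ^ m * Real.sqrt ((1 / 2 : ℝ) ^ m)))))) ≤ Z 1 := by
    intro m hb1
    have hs : (0 : ℝ) < (1 / 2) ^ m := by positivity
    have hb0 : 0 ≤ (1 / 2 : ℝ) ^ m * Ē + K * ((1 / 2 : ℝ) ^ m * Real.sqrt ((1 / 2 : ℝ) ^ m)) := by
      positivity
    generalize hsd : (1 / 2 : ℝ) ^ m = s at hs hb0 hb1 ⊢
    generalize hbd : s * Ē + K * (s * Real.sqrt s) = b at hb0 hb1 ⊢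
    have h1b : 0 < 1 - b := by linarith
    have h2m : (2 : ℝ) ^ m * s = 1 := by rw [← hsd, ← mul_pow]; norm_num
    have hexp_eq : Real.exp (-((Ē + K * Real.sqrt s) / (1 - b))) =
        Real.exp (-(b / (1 - b))) ^ (2 ^ m) := by
      rw [← Real.exp_nat_mul]
      congr 1
      have : ((2 ^ m : ℕ) : ℝ) * b = Ē + K * Real.sqrt s := by
        push_cast
        rw [← hbd]
        calc (2 : ℝ) ^ m * (s * Ē + K * (s * Real.sqrt s))
            = ((2 : ℝ) ^ m * s) * Ē + K * (((2 : ℝ) ^ m * s) * Real.sqrt s) := by ring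
          _ = Ē + K * Real.sqrt s := by rw [h2m, one_mul, one_mul]
      rw [← this, mul_neg, mul_div_assoc]
    rw [hexp_eq]
    have hZs : 1 - b ≤ Z s := hbd ▸ hZlow s hs
    calc Real.exp (-(b / (1 - b))) ^ 2 ^ m ≤ (1 - b) ^ 2 ^ m :=
          pow_le_pow_left₀ (Real.exp_pos _).le (exp_neg_div_le_one_sub hb0 hb1) _
      _ ≤ Z s ^ 2 ^ m := pow_le_pow_left₀ h1b.le hZs _
      _ ≤ Z 1 := hsd ▸ hZpow m
  -- the limit `m → ∞`
  have hs0 : Tendsto (fun m : ℕ => (1 / 2 : ℝ) ^ m) atTop (𝓝 0) :=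
    tendsto_pow_atTop_nhds_zero_of_lt_one (by norm_num) (by norm_num)
  have hsq0 : Tendsto (fun m : ℕ => Real.sqrt ((1 / 2 : ℝ) ^ m)) atTop (𝓝 0) := by
    have h := (Real.continuous_sqrt.tendsto 0).comp hs0
    rwa [Real.sqrt_zero] at h
  have hb0 : Tendsto (fun m : ℕ => (1 / 2 : ℝ) ^ m * Ē +
      K * ((1 / 2 : ℝ) ^ m * Real.sqrt ((1 / 2 : ℝ) ^ m))) atTop (𝓝 0) := by
    have h := (hs0.mul_const Ē).add ((hs0.mul hsq0).const_mul K)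
    simpa using h
  have hnum : Tendsto (fun m : ℕ => Ē + K * Real.sqrt ((1 / 2 : ℝ) ^ m)) atTop (𝓝 Ē) := by
    have h := (tendsto_const_nhds (x := Ē)).add (hsq0.const_mul K)
    simpa using h
  have hden : Tendsto (fun m : ℕ => 1 - ((1 / 2 : ℝ) ^ m * Ē +
      K * ((1 / 2 : ℝ) ^ m * Real.sqrt ((1 / 2 : ℝ) ^ m)))) atTop (𝓝 1) := by
    simpa using (tendsto_const_nhds (x := (1 : ℝ))).sub hb0
  have hq := hnum.div hden one_ne_zero
  rw [div_one] at hq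
  have hlim := (Real.continuous_exp.tendsto _).comp hq.neg
  have hev : ∀ᶠ m : ℕ in atTop, (1 / 2 : ℝ) ^ m * Ē +
      K * ((1 / 2 : ℝ) ^ m * Real.sqrt ((1 / 2 : ℝ) ^ m)) < 1 :=
    hb0.eventually (eventually_lt_nhds one_pos)
  exact le_of_tendsto hlim (hev.mono fun m hm => hkey m hm)

set_option maxHeartbeats 400000 in
/-- **Jensen's bound for the torus Feynman–Kac semigroup on a pair of periodic `C¹` functions.**
For periodic `C¹` real `f, g` with `‖f‖²_cell + ‖g‖²_cell = 1` and finite real energies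
`𝓔ℝ[f] = ∫_cell|∇f|² + ∫_cell V^per f²`, `𝓔ℝ[g]`:
`e^{-(𝓔ℝ[f] + 𝓔ℝ[g])} ≤ ⟨f, e^{-H}f⟩_cell + ⟨g, e^{-H}g⟩_cell`. Proof: `Z(s) = ⟨f,e^{-sH}f⟩ + ⟨g,e^{-sH}g⟩`
satisfies `Z(s/2)² ≤ Z(s)` (semigroup law, symmetry, Cauchy–Schwarz) and
`Z(s) ≥ 1 - s𝓔 - K s√s` (`form_upper_bound_periodic`), so `exp_neg_le_of_sq_half_le` applies. This is
Jensen's inequality `∫e^{-λ}dμ_Ψ ≥ e^{-∫λ dμ_Ψ}` for the spectral measure, without the spectral theorem.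
[cite: ChungZhao1995, Thm 3.27 and Prop 3.29 (81)] -/
theorem exp_neg_energy_le_inner_pfkL2 (hv : Measurable v) (hL : 0 < L) {C : ℝ≥0}
    (hC : ∀ x, periodizedPotential v L x ≤ C) {f g : Config M → ℝ} (hfC : ContDiff ℝ 1 f)
    (hgC : ContDiff ℝ 1 g)
    (hfper : ∀ (X : Config M) (i : Fin M) (k : Fin 3),
      f (X + Pi.single i (EuclideanSpace.single k L)) = f X)
    (hgper : ∀ (X : Config M) (i : Fin M) (k : Fin 3),
      g (X + Pi.single i (EuclideanSpace.single k L)) = g X)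
    (hf : MemLp f 2 (volume.restrict (cellN M L))) (hg : MemLp g 2 (volume.restrict (cellN M L)))
    (hnorm : ‖hf.toLp f‖ ^ 2 + ‖hg.toLp g‖ ^ 2 = 1)
    (hKf : ∫⁻ X in cellN M L, realKinetic f X ≠ ⊤)
    (hPf : ∫⁻ X in cellN M L, ENNReal.ofReal (f X ^ 2) * periodicInteraction v L X ≠ ⊤)
    (hKg : ∫⁻ X in cellN M L, realKinetic g X ≠ ⊤)
    (hPg : ∫⁻ X in cellN M L, ENNReal.ofReal (g X ^ 2) * periodicInteraction v L X ≠ ⊤) :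
    Real.exp (-(((∫⁻ X in cellN M L, realKinetic f X).toReal +
        (∫⁻ X in cellN M L, ENNReal.ofReal (f X ^ 2) * periodicInteraction v L X).toReal) +
      ((∫⁻ X in cellN M L, realKinetic g X).toReal +
        (∫⁻ X in cellN M L, ENNReal.ofReal (g X ^ 2) * periodicInteraction v L X).toReal))) ≤
      ⟪pfkL2 v L 1 (hf.toLp f), hf.toLp f⟫_ℝ + ⟪pfkL2 v L 1 (hg.toLp g), hg.toLp g⟫_ℝ := by
  obtain ⟨K₁, hK₁, hb1⟩ := form_upper_bound_periodic hv hL hC hfC hfper hKf hPf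
  obtain ⟨K₂, hK₂, hb2⟩ := form_upper_bound_periodic hv hL hC hgC hgper hKg hPg
  generalize hEf : (∫⁻ X in cellN M L, realKinetic f X).toReal +
      (∫⁻ X in cellN M L, ENNReal.ofReal (f X ^ 2) * periodicInteraction v L X).toReal = Ef at hb1 ⊢
  generalize hEg : (∫⁻ X in cellN M L, realKinetic g X).toReal +
      (∫⁻ X in cellN M L, ENNReal.ofReal (g X ^ 2) * periodicInteraction v L X).toReal = Eg at hb2 ⊢
  have hEf0 : 0 ≤ Ef := by rw [← hEf]; positivity
  have hEg0 : 0 ≤ Eg := by rw [← hEg]; positivity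
  have hmass : (∫ X in cellN M L, f X ^ 2) + ∫ X in cellN M L, g X ^ 2 = 1 := by
    rw [← norm_toLp_sq hf, ← norm_toLp_sq hg]; exact hnorm
  refine exp_neg_le_of_sq_half_le (Z := fun s => ⟪pfkL2 v L s (hf.toLp f), hf.toLp f⟫_ℝ +
    ⟪pfkL2 v L s (hg.toLp g), hg.toLp g⟫_ℝ) (K := K₁ + K₂) (add_nonneg hEf0 hEg0)
    (add_nonneg hK₁ hK₂) (fun s hs => ?_) (fun s hs => ?_)
  · -- log-convexity at the origin: `Z(s/2)² ≤ Z(s)`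
    show _ ^ 2 ≤ _
    have hs2 : 0 < s / 2 := half_pos hs
    rw [inner_pfkL2_self_eq_norm_sq hv hL hs, inner_pfkL2_self_eq_norm_sq hv hL hs]
    have e2 : ⟪pfkL2 v L (s / 2) (hf.toLp f), hf.toLp f⟫_ℝ + ⟪pfkL2 v L (s / 2) (hg.toLp g), hg.toLp g⟫_ℝ
        ≤ ‖pfkL2 v L (s / 2) (hf.toLp f)‖ * ‖hf.toLp f‖ + ‖pfkL2 v L (s / 2) (hg.toLp g)‖ * ‖hg.toLp g‖ :=
      add_le_add (real_inner_le_norm _ _) (real_inner_le_norm _ _)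
    have e3 : 0 ≤ ⟪pfkL2 v L (s / 2) (hf.toLp f), hf.toLp f⟫_ℝ +
        ⟪pfkL2 v L (s / 2) (hg.toLp g), hg.toLp g⟫_ℝ :=
      add_nonneg (inner_pfkL2_self_nonneg hv hL hs2 _) (inner_pfkL2_self_nonneg hv hL hs2 _)
    generalize ‖pfkL2 v L (s / 2) (hf.toLp f)‖ = p at e2 ⊢
    generalize ‖pfkL2 v L (s / 2) (hg.toLp g)‖ = q at e2 ⊢
    generalize ‖hf.toLp f‖ = a at e2 hnorm ⊢
    generalize ‖hg.toLp g‖ = b at e2 hnorm ⊢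
    generalize ⟪pfkL2 v L (s / 2) (hf.toLp f), hf.toLp f⟫_ℝ +
        ⟪pfkL2 v L (s / 2) (hg.toLp g), hg.toLp g⟫_ℝ = z at e2 e3 ⊢
    calc z ^ 2 ≤ (p * a + q * b) ^ 2 := pow_le_pow_left₀ e3 e2 2
      _ ≤ (p ^ 2 + q ^ 2) * (a ^ 2 + b ^ 2) := by nlinarith [sq_nonneg (p * b - q * a)]
      _ = p ^ 2 + q ^ 2 := by rw [hnorm, mul_one]
  · -- the small-time form bound
    show _ ≤ _
    set s' : ℝ≥0 := ⟨s, hs.le⟩ with hs'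
    have hss : (s' : ℝ) = s := rfl
    have hs0 : s' ≠ 0 := fun h => hs.ne' (by rw [← hss, h]; rfl)
    have h1 := hb1 s' hs0
    have h2 := hb2 s' hs0
    rw [hss] at h1 h2
    rw [inner_pfkL2_toLp hv hL hs hf hf hfper, inner_pfkL2_toLp hv hL hs hg hg hgper]
    have : s * (Ef + Eg) + (K₁ + K₂) * (s * Real.sqrt s) =
        (s * Ef + K₁ * (s * Real.sqrt s)) + (s * Eg + K₂ * (s * Real.sqrt s)) := by ring
    rw [this]
    linarith

/-- **Jensen's bound for the torus Feynman–Kac semigroup, function form** (the registered sub-goal of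
this file). For periodic `C¹` real `f, g` on `(ℝ³)^M` with `∫_cell f² + ∫_cell g² = 1` and finite real
energies `𝓔ℝ[f] = ∫_cell|∇f|² + ∫_cell V^per f²`, `𝓔ℝ[g]` (`L > 0`, bounded `v^per`):
`e^{-(𝓔ℝ[f] + 𝓔ℝ[g])} ≤ ∫_cell f·e^{-H}f + ∫_cell g·e^{-H}g` — i.e. `⟨Ψ, e^{-H}Ψ⟩_cell ≥ e^{-𝓔^per[Ψ]}` for
the complex function `Ψ = f + ig` (`exp_neg_energy_le_inner_pfkL2` read on functions).
[cite: ChungZhao1995, Thm 3.27 and Prop 3.29 (81)] -/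
theorem exp_neg_energy_le_pairing {M : ℕ} {L : ℝ} {v : ℝ → ℝ≥0∞} (hv : Measurable v) (hL : 0 < L)
    {C : ℝ≥0} (hC : ∀ x, periodizedPotential v L x ≤ C) {f g : Config M → ℝ} (hfC : ContDiff ℝ 1 f)
    (hgC : ContDiff ℝ 1 g)
    (hfper : ∀ (X : Config M) (i : Fin M) (k : Fin 3),
      f (X + Pi.single i (EuclideanSpace.single k L)) = f X)
    (hgper : ∀ (X : Config M) (i : Fin M) (k : Fin 3),
      g (X + Pi.single i (EuclideanSpace.single k L)) = g X)
    (hnorm : (∫⁻ X in cellN M L, ENNReal.ofReal (f X ^ 2)) +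
      ∫⁻ X in cellN M L, ENNReal.ofReal (g X ^ 2) = 1)
    (hKf : ∫⁻ X in cellN M L, realKinetic f X ≠ ⊤)
    (hPf : ∫⁻ X in cellN M L, ENNReal.ofReal (f X ^ 2) * periodicInteraction v L X ≠ ⊤)
    (hKg : ∫⁻ X in cellN M L, realKinetic g X ≠ ⊤)
    (hPg : ∫⁻ X in cellN M L, ENNReal.ofReal (g X ^ 2) * periodicInteraction v L X ≠ ⊤) :
    Real.exp (-(((∫⁻ X in cellN M L, realKinetic f X).toReal +
        (∫⁻ X in cellN M L, ENNReal.ofReal (f X ^ 2) * periodicInteraction v L X).toReal) +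
      ((∫⁻ X in cellN M L, realKinetic g X).toReal +
        (∫⁻ X in cellN M L, ENNReal.ofReal (g X ^ 2) * periodicInteraction v L X).toReal))) ≤
      (∫ X in cellN M L, f X * pfkReal v L 1 f X) + ∫ X in cellN M L, g X * pfkReal v L 1 g X := by
  have hf : MemLp f 2 (volume.restrict (cellN M L)) :=
    memLp_two_cellN_of_continuous_periodic hL hfC.continuous hfper
  have hg : MemLp g 2 (volume.restrict (cellN M L)) :=
    memLp_two_cellN_of_continuous_periodic hL hgC.continuous hgper
  have hnorm' : ‖hf.toLp f‖ ^ 2 + ‖hg.toLp g‖ ^ 2 = 1 := by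
    rw [← ofReal_norm_toLp_sq hf, ← ofReal_norm_toLp_sq hg,
      ← ENNReal.ofReal_add (sq_nonneg _) (sq_nonneg _)] at hnorm
    have := congrArg ENNReal.toReal hnorm
    rwa [ENNReal.toReal_ofReal (by positivity), ENNReal.toReal_one] at this
  have h := exp_neg_energy_le_inner_pfkL2 hv hL hC hfC hgC hfper hgper hf hg hnorm' hKf hPf hKg hPg
  rwa [inner_pfkL2_toLp hv hL one_pos hf hf hfper, inner_pfkL2_toLp hv hL one_pos hg hg hgper] at h

end Summit.AtomisticToContinuum.BoseEinsteinCondensation.Theorems.CorrectorClosure.HealingScaleKacInsertion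

end
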